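import Mathlib
import HarnessLib
import Literature.MathematicalPhysics.QuantumFieldTheory.FariaDaVeigaOCarroll2022.FdVOC22MultiReflectionBound
import Literature.MathematicalPhysics.QuantumLattice.CloverPseudoscalarParity
import Literature.MathematicalPhysics.QuantumLattice.CloverObservables
import Summits.Ventures.LatticeQCDFlow.Scoring.WilsonFlowRK3Consistency

/-!
# The RK3 Wilson flow is LOCAL IN TIME (radius `3m` links after `m` steps), so the MEASURED slab charge of a slice deep in the half-space is a half-space observable — and its correlator with the mirror slice is non-positive, for every `β`

HONEST FRAMING: exact (Metropolis-corrected) sampling algorithms for lattice gauge theory;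
figures of merit are autocorrelation/cost numbers at stated couplings and volumes; no
continuum-physics claim.

Venture `LatticeQCDFlow` (cell pub-lqcd), topic `Exactness`, FANOUT row 21 (`su3-base`: the scored charge of the row is the
clover charge of the SMOOTHED field, `Q_m = Σ_x P_x ∘ RK3_{ε'}^m` on the exactness subset; row 21's
`Exactness/FlowedChargeCorrelatorRP` reduced reflection positivity for smoothed charges to two hypotheses — covariance of the
smoothing map, which row 16's `Scoring/WilsonFlowRK3Reflection.iterate_wilsonFlowRK3_negReflect` supplies, and SUPPORT of the
smoothed observable in the half-space, left there as the hypothesis `hdep`).  THIS FILE DISCHARGES THE SUPPORT HYPOTHESIS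
for the engine's integrator: Lüscher's RK3 step (row 16's `Scoring/WilsonFlowRK3`: registers `rkRegister`, pushes `rkPush`,
generator `flowGen = −P(Ω)` with the Literature's `plaquetteLoopSum`) reads, for each link, only the plaquettes through it,
hence only links based within ONE time slice of it; three stages per step give a time radius `3`, `m` steps a radius `3m`.
NEW WORK of the cell, def-free; nothing is cited as a fact; no number.  Tools: the Literature's reflection positivity
(`FariaDaVeigaOCarroll2022.integral_mul_negReflect_nonneg`, site plane, EVERY real `β`), the parity of the clover density
(`CloverPseudoscalarParity.cloverPseudoscalar_reflect`) and its locality (`flowedClover_zero_congr`, `cloverEdges`).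

Windows are by the time value of the BASE site of a link (`d = 4`, time axis `0`, values in `ℕ`, no wrap-around inside the
stated ranges):
* §1 `zmod_val_pred_succ`, `val_mem_window_of_mem3` (bookkeeping of `t ± 1`).
* §2 **`flowGen_eq_of_agree`** — agreement of two configurations on the links based in `[lo − 1, hi + 1]` gives agreement of
  the generator `Z(V)(x, μ)` for `x₀ ∈ [lo, hi]` (`1 ≤ lo`, `hi + 1 < L`): the eight links of `Ω_{x,μ}` are based at times
  `x₀ − 1, x₀, x₀ + 1`.
* §3 `rkRegister_eq_of_agree`, `rkPush_eq_of_agree`, **`wilsonFlowRK3_eq_of_agree`** (ONE STEP: `[lo − 3, hi + 3] → [lo, hi]`,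
  through the three stages `[lo−2,hi+2] → [lo−1,hi+1] → [lo,hi]`) and **`iterate_wilsonFlowRK3_eq_of_agree`** (`m` STEPS:
  `[lo − 3m, hi + 3m] → [lo, hi]`).
* §4 **`dependsOn_rk3SlabCharge`** — for a slice `t` with `3m + 1 ≤ t.val` and `t.val + 3m + 2 ≤ L/2` the flowed slab charge
  `Σ_{x₀ = t} P_x ∘ RK3_{ε'}^m` depends only on the site-positive and shared links of the site reflection (the clover at `x`
  reads links based at `x₀ − 1, x₀, x₀ + 1`; those are determined by the bare links based in `[t.val − 1 − 3m, t.val + 1 + 3m]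
  ⊆ [0, L/2 − 1]`, all site-positive or shared).
* §5 **`integral_rk3SlabCharge_mul_mirror_nonpos`** — THE MEASURED SLAB CHARGE ACROSS THE SITE PLANE: for `SU(n)` (fundamental
  representation), `L` even, EVERY `β`, every `ε'`, `m` and every slice with `3m + 1 ≤ t.val`, `t.val + 3m + 2 ≤ L/2`:
  `∫ (Σ_{x₀=t} P_x ∘ RK3^m)·(Σ_{x₀=t} P_{θ'x} ∘ RK3^m) dμ_β ≤ 0` (the second factor is the flowed charge of the slice `−t`;
  time separation `2 t.val`).  No hypothesis is left: at flow depth `m` the negativity of the slab-charge correlator is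
  certified for every separation `2t.val` with `6m + 2 ≤ 2t.val ≤ L − 6m − 4`.
NOT CLAIMED: that `3m` is the sharp footprint (it is an upper bound from the scheme's three stages; the true support of one
step is the radius-`1` plaquette neighbourhood iterated thrice).  PLAINLY: the strict support of the discrete scheme grows
LINEARLY in the number of steps, whereas the flow's smoothing radius `√(8t)` grows diffusively — for the row's step counts at
`t ≈ t₀` the certified range of slices is empty on its lattices, and the theorem bites only at small `m` or large `L`; decay of
the flowed density's dependence outside `√(8t)` (which would give an approximate statement at every `m`) is not claimed.  Also
not claimed: the link plane / odd separations (the link-reflection covariance of `RK3` is not in the tree); spatial windows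
(only the time direction is tracked); anything inside the footprint; numbers.
-/
noncomputable section

namespace Summit.Ventures.LatticeQCDFlow.Exactness

open MeasureTheory
open Literature.MathematicalPhysics.QuantumFieldTheory
open Literature.MathematicalPhysics.QuantumLattice (cloverPseudoscalar cloverPseudoscalar_reflect continuous_cloverPseudoscalar
  exists_abs_cloverPseudoscalar_le cloverPseudoscalar_congr cloverSiteEdges cloverEdges fundamentalRep continuous_fundamentalRep
  fundamentalRep_mem_unitaryGroup)
open Summit.Ventures.LatticeQCDFlow.Scoring (flowGen rkRegister rkPush wilsonFlowRK3 iterate_wilsonFlowRK3_negReflect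
  continuous_iterate_wilsonFlowRK3)

/-! ## §1 Time windows -/

section Window

variable {L : ℕ} [NeZero L]

/-- Values of the neighbouring residues when there is no wrap-around: `(t − 1).val = t.val − 1` and
`(t + 1).val = t.val + 1` for `1 ≤ t.val` and `t.val + 1 < L`. -/
theorem zmod_val_pred_succ {t : ZMod L} (h1 : 1 ≤ t.val) (hL : t.val + 1 < L) :
    (t - 1).val = t.val - 1 ∧ (t + 1).val = t.val + 1 := by
  haveI : Fact (1 < L) := ⟨by omega⟩
  have h1' : (1 : ZMod L).val ≤ t.val := by rw [ZMod.val_one]; exact h1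
  constructor
  · rw [ZMod.val_sub h1', ZMod.val_one]
  · rw [ZMod.val_add_of_lt (by rw [ZMod.val_one]; exact hL), ZMod.val_one]

/-- From a time in `{x₀, x₀ − 1, x₀ + 1}` to the window of values `[x₀.val − 1, x₀.val + 1]` (no wrap-around). -/
theorem val_mem_window_of_mem3 {x0 y0 : ZMod L} (h1 : 1 ≤ x0.val) (hL : x0.val + 1 < L)
    (hy : y0 = x0 ∨ y0 = x0 - 1 ∨ y0 = x0 + 1) : x0.val - 1 ≤ y0.val ∧ y0.val ≤ x0.val + 1 := by
  obtain ⟨hp, hs⟩ := zmod_val_pred_succ h1 hL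
  rcases hy with rfl | rfl | rfl
  · omega
  · rw [hp]; omega
  · rw [hs]; omega

end Window

/-! ## §2 Locality of the generator: `Z(V)(x, μ)` reads links based within one time slice of `x` -/

section Generator

variable {L n : ℕ} [NeZero L]

/-- **The Wilson-flow generator is local in time**: two `SU(n)` configurations that agree on every link BASED at a site of time
value in `[lo − 1, hi + 1]` have the same generator `Z(V)(x, μ)` at every link based at a time value in `[lo, hi]`
(`1 ≤ lo`, `hi + 1 < L`; `d = 4`, time axis `0`). -/
theorem flowGen_eq_of_agree {V V' : GaugeConfig 4 L (Matrix.specialUnitaryGroup (Fin n) ℂ)} {lo hi : ℕ} (hlo : 1 ≤ lo)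
    (hhi : hi + 1 < L) (h : ∀ e : Edge 4 L, lo - 1 ≤ (e.1 0).val → (e.1 0).val ≤ hi + 1 → V e = V' e)
    (x : Site 4 L) (μ : Fin 4) (h1 : lo ≤ (x 0).val) (h2 : (x 0).val ≤ hi) :
    flowGen V (x, μ) = flowGen V' (x, μ) := by
  suffices hΩ : plaquetteLoopSum V x μ = plaquetteLoopSum V' x μ by
    apply Subtype.ext
    rw [Scoring.coe_flowGen, Scoring.coe_flowGen, hΩ]
  unfold plaquetteLoopSum
  refine Finset.sum_congr rfl fun ν _ => ?_
  by_cases hνμ : ν = μ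
  · rw [if_pos hνμ, if_pos hνμ]
  rw [if_neg hνμ, if_neg hνμ]
  have hμν : μ ≠ ν := fun h => hνμ h.symm
  -- every link based at a time in `{x₀, x₀ − 1, x₀ + 1}` is read identically by `V` and `V'`
  have hb : ∀ (y : Site 4 L) (i : Fin 4), (y 0 = x 0 ∨ y 0 = x 0 - 1 ∨ y 0 = x 0 + 1) → V (y, i) = V' (y, i) := by
    intro y i hy
    obtain ⟨ha, hb⟩ := val_mem_window_of_mem3 (by omega) (by omega) hy
    exact h (y, i) (by simp only; omega) (by simp only; omega)
  -- the time coordinates of the base sites of the eight links involved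
  have m1 : ((x + Pi.single μ 1 : Site 4 L) 0) = x 0 ∨ ((x + Pi.single μ 1 : Site 4 L) 0) = x 0 - 1 ∨ ((x + Pi.single μ 1 : Site 4 L) 0) = x 0 + 1 := by
    by_cases hμ : μ = 0
    · subst hμ; simp
    · simp [Ne.symm hμ]
  have m2 : ((x + Pi.single ν 1 : Site 4 L) 0) = x 0 ∨ ((x + Pi.single ν 1 : Site 4 L) 0) = x 0 - 1 ∨ ((x + Pi.single ν 1 : Site 4 L) 0) = x 0 + 1 := by
    by_cases hν : ν = 0
    · subst hν; simp
    · simp [Ne.symm hν]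
  have m3 : ((x - Pi.single ν 1 : Site 4 L) 0) = x 0 ∨ ((x - Pi.single ν 1 : Site 4 L) 0) = x 0 - 1 ∨ ((x - Pi.single ν 1 : Site 4 L) 0) = x 0 + 1 := by
    by_cases hν : ν = 0
    · subst hν; simp
    · simp [Ne.symm hν]
  have m4 : ((x - Pi.single ν 1 + Pi.single ν 1 : Site 4 L) 0) = x 0 ∨ ((x - Pi.single ν 1 + Pi.single ν 1 : Site 4 L) 0) = x 0 - 1 ∨
      ((x - Pi.single ν 1 + Pi.single ν 1 : Site 4 L) 0) = x 0 + 1 := by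
    left; simp
  have m5 : ((x - Pi.single ν 1 + Pi.single μ 1 : Site 4 L) 0) = x 0 ∨ ((x - Pi.single ν 1 + Pi.single μ 1 : Site 4 L) 0) = x 0 - 1 ∨
      ((x - Pi.single ν 1 + Pi.single μ 1 : Site 4 L) 0) = x 0 + 1 := by
    by_cases hμ : μ = 0
    · subst hμ
      have hν : ν ≠ 0 := fun h => hμν h.symm
      simp [Ne.symm hν]
    · by_cases hν : ν = 0
      · subst hν; simp [Ne.symm hμ]
      · simp [Ne.symm hμ, Ne.symm hν]
  simp only [plaquetteHolonomy, Site.shift]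
  rw [hb x μ (Or.inl rfl), hb x ν (Or.inl rfl), hb _ ν m1, hb _ μ m2, hb _ ν m3, hb _ μ m3, hb _ μ m4, hb _ ν m5]

end Generator

/-! ## §3 One RK3 step reads three time slices around each link; `m` steps read `3m` -/

section Step

variable {L n : ℕ} [NeZero L]

/-- Registers: if the previous registers agree on the base-window `[lo, hi]` and the fields agree on `[lo − 1, hi + 1]`, the
updated registers agree on `[lo, hi]`. -/
theorem rkRegister_eq_of_agree {X X' : Edge 4 L → suAlgebra n}
    {W W' : GaugeConfig 4 L (Matrix.specialUnitaryGroup (Fin n) ℂ)} {lo hi : ℕ} (hlo : 1 ≤ lo) (hhi : hi + 1 < L) (a b ε : ℝ)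
    (hX : ∀ e : Edge 4 L, lo ≤ (e.1 0).val → (e.1 0).val ≤ hi → X e = X' e)
    (hW : ∀ e : Edge 4 L, lo - 1 ≤ (e.1 0).val → (e.1 0).val ≤ hi + 1 → W e = W' e)
    (e : Edge 4 L) (h1 : lo ≤ (e.1 0).val) (h2 : (e.1 0).val ≤ hi) :
    rkRegister a b ε X W e = rkRegister a b ε X' W' e := by
  obtain ⟨x, μ⟩ := e
  unfold rkRegister
  rw [flowGen_eq_of_agree hlo hhi hW x μ h1 h2, hX (x, μ) h1 h2]

omit [NeZero L] in
/-- The exponential push is pointwise. -/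
theorem rkPush_eq_of_agree {X X' : Edge 4 L → suAlgebra n}
    {W W' : GaugeConfig 4 L (Matrix.specialUnitaryGroup (Fin n) ℂ)} (e : Edge 4 L) (hX : X e = X' e) (hW : W e = W' e) :
    rkPush X W e = rkPush X' W' e := by
  unfold rkPush
  rw [hX, hW]

/-- **ONE RK3 STEP IS LOCAL IN TIME WITH RADIUS THREE**: two configurations that agree on every link based at a time value in
`[lo − 3, hi + 3]` flow, in one step of Lüscher's scheme, to configurations that agree on every link based in `[lo, hi]`
(`3 ≤ lo`, `hi + 3 < L`). -/
theorem wilsonFlowRK3_eq_of_agree {V V' : GaugeConfig 4 L (Matrix.specialUnitaryGroup (Fin n) ℂ)} {lo hi : ℕ}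
    (hlo : 3 ≤ lo) (hhi : hi + 3 < L) (ε : ℝ)
    (h : ∀ e : Edge 4 L, lo - 3 ≤ (e.1 0).val → (e.1 0).val ≤ hi + 3 → V e = V' e)
    (e : Edge 4 L) (h1 : lo ≤ (e.1 0).val) (h2 : (e.1 0).val ≤ hi) :
    wilsonFlowRK3 ε V e = wilsonFlowRK3 ε V' e := by
  -- stage 1: registers and field on `[lo − 2, hi + 2]`
  have hX1 : ∀ e : Edge 4 L, lo - 2 ≤ (e.1 0).val → (e.1 0).val ≤ hi + 2 →
      rkRegister (1 / 4) 0 ε (fun _ => 0) V e = rkRegister (1 / 4) 0 ε (fun _ => 0) V' e := fun e he1 he2 =>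
    rkRegister_eq_of_agree (lo := lo - 2) (hi := hi + 2) (by omega) (by omega) _ _ _ (fun _ _ _ => rfl)
      (fun e' h1' h2' => h e' (by omega) (by omega)) e he1 he2
  have hW1 : ∀ e : Edge 4 L, lo - 2 ≤ (e.1 0).val → (e.1 0).val ≤ hi + 2 →
      rkPush (rkRegister (1 / 4) 0 ε (fun _ => 0) V) V e = rkPush (rkRegister (1 / 4) 0 ε (fun _ => 0) V') V' e :=
    fun e he1 he2 => rkPush_eq_of_agree e (hX1 e he1 he2) (h e (by omega) (by omega))
  -- stage 2: on `[lo − 1, hi + 1]`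
  have hX2 : ∀ e : Edge 4 L, lo - 1 ≤ (e.1 0).val → (e.1 0).val ≤ hi + 1 →
      rkRegister (8 / 9) (-17 / 9) ε (rkRegister (1 / 4) 0 ε (fun _ => 0) V)
          (rkPush (rkRegister (1 / 4) 0 ε (fun _ => 0) V) V) e =
        rkRegister (8 / 9) (-17 / 9) ε (rkRegister (1 / 4) 0 ε (fun _ => 0) V')
          (rkPush (rkRegister (1 / 4) 0 ε (fun _ => 0) V') V') e := fun e he1 he2 =>
    rkRegister_eq_of_agree (lo := lo - 1) (hi := hi + 1) (by omega) (by omega) _ _ _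
      (fun e' h1' h2' => hX1 e' (by omega) (by omega)) (fun e' h1' h2' => hW1 e' (by omega) (by omega)) e he1 he2
  have hW2 : ∀ e : Edge 4 L, lo - 1 ≤ (e.1 0).val → (e.1 0).val ≤ hi + 1 →
      rkPush (rkRegister (8 / 9) (-17 / 9) ε (rkRegister (1 / 4) 0 ε (fun _ => 0) V)
          (rkPush (rkRegister (1 / 4) 0 ε (fun _ => 0) V) V)) (rkPush (rkRegister (1 / 4) 0 ε (fun _ => 0) V) V) e =
        rkPush (rkRegister (8 / 9) (-17 / 9) ε (rkRegister (1 / 4) 0 ε (fun _ => 0) V')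
          (rkPush (rkRegister (1 / 4) 0 ε (fun _ => 0) V') V')) (rkPush (rkRegister (1 / 4) 0 ε (fun _ => 0) V') V') e :=
    fun e he1 he2 => rkPush_eq_of_agree e (hX2 e he1 he2) (hW1 e (by omega) (by omega))
  -- stage 3: on `[lo, hi]`
  have hX3 := rkRegister_eq_of_agree (lo := lo) (hi := hi) (by omega) (by omega) (3 / 4) (-1) ε
    (fun e' h1' h2' => hX2 e' (by omega) (by omega)) (fun e' h1' h2' => hW2 e' (by omega) (by omega)) e h1 h2
  show rkPush _ _ e = rkPush _ _ e
  exact rkPush_eq_of_agree e hX3 (hW2 e (by omega) (by omega))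

/-- **`m` RK3 STEPS ARE LOCAL IN TIME WITH RADIUS `3m`**: agreement on the base-window `[lo − 3m, hi + 3m]` gives agreement of the
`m`-fold flowed fields on `[lo, hi]` (`3m ≤ lo`, `hi + 3m < L`). -/
theorem iterate_wilsonFlowRK3_eq_of_agree (ε : ℝ) (m : ℕ) :
    ∀ {V V' : GaugeConfig 4 L (Matrix.specialUnitaryGroup (Fin n) ℂ)} {lo hi : ℕ}, 3 * m ≤ lo → hi + 3 * m < L →
      (∀ e : Edge 4 L, lo - 3 * m ≤ (e.1 0).val → (e.1 0).val ≤ hi + 3 * m → V e = V' e) →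
      ∀ e : Edge 4 L, lo ≤ (e.1 0).val → (e.1 0).val ≤ hi → (wilsonFlowRK3 ε)^[m] V e = (wilsonFlowRK3 ε)^[m] V' e := by
  induction m with
  | zero =>
    intro V V' lo hi _ _ h e h1 h2
    simp only [Function.iterate_zero, id_eq]
    exact h e (by omega) (by omega)
  | succ m ih =>
    intro V V' lo hi hlo hhi h e h1 h2
    rw [Function.iterate_succ_apply', Function.iterate_succ_apply']
    refine wilsonFlowRK3_eq_of_agree (lo := lo) (hi := hi) (by omega) (by omega) ε (fun e' h1' h2' => ?_) e h1 h2
    exact ih (lo := lo - 3) (hi := hi + 3) (by omega) (by omega) (fun e'' g1 g2 => h e'' (by omega) (by omega)) e' h1' h2'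

end Step

/-! ## §4 The flowed slab charge of a slice deep in the half-space is an observable of the site-positive and shared links -/

section Support

variable {L n : ℕ} [NeZero L]

/-- **SUPPORT OF THE FLOWED SLAB CHARGE**: for a slice `t` with `3m + 1 ≤ t.val` and `t.val + 3m + 2 ≤ L/2`, the flowed slab
charge `Σ_{x : x₀ = t} P_x(RK3_{ε'}^m U)` depends only on the site-positive and shared links of the site reflection. -/
theorem dependsOn_rk3SlabCharge (ε' : ℝ) (m : ℕ) (t : ZMod L) (hlo : 3 * m + 1 ≤ t.val) (hhi : t.val + 3 * m + 2 ≤ L / 2) :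
    DependsOn (fun U : GaugeConfig 4 L (Matrix.specialUnitaryGroup (Fin n) ℂ) =>
        ∑ x ∈ Finset.univ.filter (fun x : Site 4 L => x 0 = t),
          cloverPseudoscalar (fundamentalRep (Fin n)) x ((wilsonFlowRK3 ε')^[m] U))
      ((WilsonSiteRP.sitePosEdges ∪ WilsonSiteRP.sharedEdges : Finset (Edge 4 L)) : Set (Edge 4 L)) := by
  have hL2 : L / 2 < L := Nat.div_lt_self (Nat.pos_of_ne_zero (NeZero.ne L)) one_lt_two
  intro U V hUV
  refine Finset.sum_congr rfl fun x hx => ?_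
  have hxt : x 0 = t := by simpa using hx
  -- the flowed fields agree on every link based at a time value in `[t − 1, t + 1]`
  have hagree : ∀ e : Edge 4 L, t.val - 1 ≤ (e.1 0).val → (e.1 0).val ≤ t.val + 1 →
      (wilsonFlowRK3 ε')^[m] U e = (wilsonFlowRK3 ε')^[m] V e := by
    refine iterate_wilsonFlowRK3_eq_of_agree ε' m (lo := t.val - 1) (hi := t.val + 1) (by omega) (by omega) ?_
    intro e h1 h2
    apply hUV
    simp only [Finset.coe_union, Set.mem_union, Finset.mem_coe, WilsonSiteRP.mem_sitePosEdges,
      WilsonSiteRP.mem_sharedEdges, WilsonSiteRP.IsSitePosEdge, WilsonSiteRP.IsSharedEdge]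
    by_cases he0 : e.2 = 0
    · left; rw [if_pos he0]; omega
    · rw [if_neg he0]
      by_cases hz : (e.1 0).val = 0
      · right; exact ⟨he0, Or.inl hz⟩
      · left; omega
  -- links based at a time in `{x₀, x₀ − 1, x₀ + 1}` are therefore read identically
  obtain ⟨hp, hs⟩ := zmod_val_pred_succ (t := x 0) (by rw [hxt]; omega) (by rw [hxt]; omega)
  have hb : ∀ e : Edge 4 L, (e.1 0 = x 0 ∨ e.1 0 = x 0 - 1 ∨ e.1 0 = x 0 + 1) →
      (wilsonFlowRK3 ε')^[m] U e = (wilsonFlowRK3 ε')^[m] V e := by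
    intro e he
    refine hagree e ?_ ?_ <;> rcases he with h | h | h <;> rw [h] <;> (try rw [hp]) <;> (try rw [hs]) <;> rw [hxt] <;> omega
  -- the clover at `x` reads only links of the six coordinate-plane clovers, all based at such times
  have h0 : ∀ i : Fin 4, i ≠ 0 → ∀ e ∈ cloverEdges x 0 i, (wilsonFlowRK3 ε')^[m] U e = (wilsonFlowRK3 ε')^[m] V e := by
    intro i hi e he
    apply hb
    simp only [cloverEdges, Finset.mem_insert, Finset.mem_singleton] at he
    rcases he with rfl | rfl | rfl | rfl | rfl | rfl | rfl | rfl | rfl | rfl | rfl | rfl <;>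
      simp [Ne.symm hi, sub_eq_add_neg, add_comm]
  have hsp : ∀ i j : Fin 4, i ≠ 0 → j ≠ 0 → ∀ e ∈ cloverEdges x i j,
      (wilsonFlowRK3 ε')^[m] U e = (wilsonFlowRK3 ε')^[m] V e := by
    intro i j hi hj e he
    apply hb
    simp only [cloverEdges, Finset.mem_insert, Finset.mem_singleton] at he
    rcases he with rfl | rfl | rfl | rfl | rfl | rfl | rfl | rfl | rfl | rfl | rfl | rfl <;>
      simp [Ne.symm hi, Ne.symm hj]
  have hC : ∀ μ ν : Fin 4, (μ = 0 ∧ ν ≠ 0) ∨ (μ ≠ 0 ∧ ν ≠ 0) →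
      Literature.MathematicalPhysics.QuantumLattice.flowedClover (fundamentalRep (Fin n)) 0 ((wilsonFlowRK3 ε')^[m] U) x μ ν =
        Literature.MathematicalPhysics.QuantumLattice.flowedClover (fundamentalRep (Fin n)) 0 ((wilsonFlowRK3 ε')^[m] V) x μ ν := by
    intro μ ν h
    rcases h with ⟨hμ, hν⟩ | ⟨hμ, hν⟩
    · subst hμ
      exact Literature.MathematicalPhysics.QuantumLattice.flowedClover_zero_congr _ (h0 ν hν)
    · exact Literature.MathematicalPhysics.QuantumLattice.flowedClover_zero_congr _ (hsp μ ν hμ hν)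
  rw [Literature.MathematicalPhysics.QuantumLattice.cloverPseudoscalar_def,
    Literature.MathematicalPhysics.QuantumLattice.cloverPseudoscalar_def,
    hC 0 1 (Or.inl ⟨rfl, by decide⟩), hC 0 2 (Or.inl ⟨rfl, by decide⟩), hC 0 3 (Or.inl ⟨rfl, by decide⟩),
    hC 2 3 (Or.inr ⟨by decide, by decide⟩), hC 1 3 (Or.inr ⟨by decide, by decide⟩), hC 1 2 (Or.inr ⟨by decide, by decide⟩)]

end Support

/-! ## §5 The flowed slab-charge correlator across the site plane is non-positive — unconditionally in the stated range -/

section Positivity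

variable {L n : ℕ} [NeZero L]

/-- **THE MEASURED (RK3-FLOWED) SLAB CHARGE ACROSS THE SITE PLANE IS NON-POSITIVELY CORRELATED WITH ITS MIRROR SLICE**:
for `SU(n)` in the fundamental representation on `(ℤ/L)⁴` with `L` even, EVERY real `β`, every flow step `ε'`, every number
`m` of RK3 steps and every slice `t` with `3m + 1 ≤ t.val` and `t.val + 3m + 2 ≤ L/2`:
`∫ (Σ_{x₀ = t} P_x ∘ RK3^m) · (Σ_{x₀ = t} P_{θ'x} ∘ RK3^m) dμ_β ≤ 0` — the second factor is the flowed charge of the slice `−t`.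
The support radius `3m` of §3 replaces the hypothesis `hdep` of row 21's `Exactness/FlowedChargeCorrelatorRP`. -/
theorem integral_rk3SlabCharge_mul_mirror_nonpos (hL : Even L) (β ε' : ℝ) (m : ℕ) (t : ZMod L) (hlo : 3 * m + 1 ≤ t.val)
    (hhi : t.val + 3 * m + 2 ≤ L / 2) :
    ∫ U, (∑ x ∈ Finset.univ.filter (fun x : Site 4 L => x 0 = t),
          cloverPseudoscalar (fundamentalRep (Fin n)) x ((wilsonFlowRK3 ε')^[m] U)) *
        (∑ x ∈ Finset.univ.filter (fun x : Site 4 L => x 0 = t),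
          cloverPseudoscalar (fundamentalRep (Fin n)) (Site.negReflect x) ((wilsonFlowRK3 ε')^[m] U))
      ∂(wilsonMeasure (d := 4) (L := L) (fundamentalRep (Fin n)) β) ≤ 0 := by
  set Φ : GaugeConfig 4 L (Matrix.specialUnitaryGroup (Fin n) ℂ) → GaugeConfig 4 L (Matrix.specialUnitaryGroup (Fin n) ℂ) :=
    (wilsonFlowRK3 ε')^[m] with hΦ
  have hΦm : Measurable Φ := (continuous_iterate_wilsonFlowRK3 ε' m).measurable
  have hρc := continuous_fundamentalRep (Fin n)
  have hρu : ∀ g : Matrix.specialUnitaryGroup (Fin n) ℂ, fundamentalRep (Fin n) g ∈ Matrix.unitaryGroup (Fin n) ℂ :=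
    fundamentalRep_mem_unitaryGroup
  -- measurability and boundedness of the flowed slab charge
  have hFm : Measurable fun U : GaugeConfig 4 L (Matrix.specialUnitaryGroup (Fin n) ℂ) =>
      ∑ x ∈ Finset.univ.filter (fun x : Site 4 L => x 0 = t), cloverPseudoscalar (fundamentalRep (Fin n)) x (Φ U) :=
    Finset.measurable_sum _ fun x _ => ((continuous_cloverPseudoscalar _ hρc x).measurable).comp hΦm
  obtain ⟨C, hC⟩ : ∃ C : ℝ, ∀ (x : Site 4 L) (W : GaugeConfig 4 L (Matrix.specialUnitaryGroup (Fin n) ℂ)),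
      |cloverPseudoscalar (fundamentalRep (Fin n)) x W| ≤ C := by
    choose c hc using fun x : Site 4 L => exists_abs_cloverPseudoscalar_le (fundamentalRep (Fin n)) hρc (R := ZMod L) x
    exact ⟨Finset.univ.sup' ⟨0, Finset.mem_univ _⟩ c, fun x W => (hc x W).trans (Finset.le_sup' c (Finset.mem_univ x))⟩
  have hFb : ∃ K : ℝ, ∀ U : GaugeConfig 4 L (Matrix.specialUnitaryGroup (Fin n) ℂ),
      |∑ x ∈ Finset.univ.filter (fun x : Site 4 L => x 0 = t), cloverPseudoscalar (fundamentalRep (Fin n)) x (Φ U)| ≤ K :=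
    ⟨∑ x ∈ Finset.univ.filter (fun x : Site 4 L => x 0 = t), C, fun U =>
      (Finset.abs_sum_le_sum_abs _ _).trans (Finset.sum_le_sum fun x _ => hC x (Φ U))⟩
  have hdep := dependsOn_rk3SlabCharge (n := n) ε' m t hlo hhi
  have key := FariaDaVeigaOCarroll2022.integral_mul_negReflect_nonneg (fundamentalRep (Fin n)) hL hρc β hFm hFb hdep
  -- oddness of the density and covariance of the flow under the site reflection
  have hodd : ∀ (W : GaugeConfig 4 L (Matrix.specialUnitaryGroup (Fin n) ℂ)) (x : Site 4 L),
      cloverPseudoscalar (fundamentalRep (Fin n)) x W.negReflect =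
        -cloverPseudoscalar (fundamentalRep (Fin n)) (Site.negReflect x) W := fun W x =>
    cloverPseudoscalar_reflect (fundamentalRep (Fin n)) hρu (Site.negReflect (d := 4) (L := L))
      (fun z => by funext k; by_cases hk : k = 0 <;> [(subst hk; simp [Site.negReflect]; ring); simp [Site.negReflect, hk]])
      (fun z i hi => by funext k; by_cases hk : k = 0 <;> [(subst hk; simp [Site.negReflect, hi.symm]); simp [Site.negReflect, hk]])
      W W.negReflect (fun z => by unfold GaugeConfig.negReflect; rw [if_pos rfl]; rfl)
      (fun z i hi => by unfold GaugeConfig.negReflect; rw [if_neg hi]) x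
  have hrefl : ∀ U : GaugeConfig 4 L (Matrix.specialUnitaryGroup (Fin n) ℂ),
      (∑ x ∈ Finset.univ.filter (fun x : Site 4 L => x 0 = t), cloverPseudoscalar (fundamentalRep (Fin n)) x (Φ U.negReflect)) =
        -∑ x ∈ Finset.univ.filter (fun x : Site 4 L => x 0 = t),
          cloverPseudoscalar (fundamentalRep (Fin n)) (Site.negReflect x) (Φ U) := by
    intro U
    rw [hΦ, iterate_wilsonFlowRK3_negReflect, ← Finset.sum_neg_distrib]
    exact Finset.sum_congr rfl fun x _ => hodd _ x
  simp only [hrefl, mul_neg, integral_neg] at key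
  simpa [hΦ] using key

end Positivity

end Summit.Ventures.LatticeQCDFlow.Exactness
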